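import Mathlib
import HarnessLib
import Summits.AtomisticToContinuum.FouriersLaw.Theses.OddSectorIrreversibility
import Literature.MathematicalPhysics.KineticTheory.LangevinChainKernel
import Literature.MathematicalPhysics.KineticTheory.LangevinChainGibbs

/-!
# Crux `OddResponseBound` (stmt-AtomisticToContinuum-9140) — ideator 2, idea `replica-parity-moment`

Sketch for the crux-idea card (round 1).  Everything is stated over existing declarations:
`pinnedChain`, `OscillatorChain.bondCurrent`, `OscillatorChain.transitionKernel` (the CONSTRUCTED
equilibrium kernels `P_t`), `OscillatorChain.gibbsMeasure` (normalised Gibbs `μ_T`), the route decls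
`OddResponseBound`, `OddDensityIsCorrector`, `NessUnique`, `GibbsSteadyState`, `CurrentVarianceLinear`,
`BoundedResponseConverges`, `FiniteResponseOfUnique`, `ResponseDensity`, `OddSufficiency`.

Objects (equilibrium, open chain, fixed `N`):
* `Jtot`      — `J = Σ_i j_i` (Θ-odd);
* `PtJ t`     — `(P_t J)(x) = ∫ J dP_t(x,·)`;
* `uTau τ`    — finite-horizon Kubo corrector `u_τ = ∫₀^τ P_tJ dt`; the corrector `u` is its a.e./L² limit (9146);
* `autocorr t` — `C(t) = ⟨J, P_tJ⟩_{μ_T}`;  `firstMoment` — `M₁ = ∫₀^∞ t C(t) dt`;  `zerothMoment` — `M₀ = ∫₀^∞ C`.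
* `‖u_τ‖²_{L²(μ_T)} = E[Q_τ Q̃_τ]` — the TWO-REPLICA overlap of the time-integrated current (same `x₀ ∼ μ_T`,
  independent bath noises), by the Markov property.

Identities of the line (all exact at fixed `N`):
(E1) `⟨u, u∘Θ⟩ = −M₁` (generalised detailed balance `P_t† = ΘP_tΘ`), hence
     `‖u − u∘Θ‖² = 2‖u‖² + 2M₁`, `‖u + u∘Θ‖² = 2‖u‖² − 2M₁ ≥ 0`, and with 9146
     `a_N := N∫(h − h∘Θ)² dμ_T = 2N(‖u‖² + M₁)/((N−1)²T⁴)`.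
(E2) `u = u_τ + P_τ u` ⇒ `‖u‖ ≥ ‖u_τ‖/2` for every `τ` (contraction only).
(E3) `‖u_τ‖² = ∫₀^τ∫₀^τ ⟨P_tJ, P_sJ⟩ ds dt = E[Q_τ Q̃_τ] ≤ Var(Q_τ)`, with equality iff the replicas agree.
-/

noncomputable section

open MeasureTheory Filter Set
open scoped BigOperators NNReal ENNReal Topology

namespace Summit.AtomisticToContinuum.FouriersLaw.Cruxes.OddResponseBound.ReplicaParityMoment

open Literature.MathematicalPhysics.KineticTheory.HeatConduction
open Summit.AtomisticToContinuum.FouriersLaw.Theses.OddSectorIrreversibility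

/-! ### Objects -/

/-- The total current `J = Σ_i j_i` of the pinned chain. -/
def Jtot (ω₂ lam β γ : ℝ) (N : ℕ) (x : PhaseSpace N) : ℝ :=
  ∑ i : Fin N, (pinnedChain ω₂ lam β γ).bondCurrent N i x

/-- The sum of the bond currents at distance `≥ w` from both ends (bulk block `B_w`). -/
def Jblock (ω₂ lam β γ : ℝ) (N w : ℕ) (x : PhaseSpace N) : ℝ :=
  ∑ i : Fin N, if w ≤ i.val ∧ i.val + 2 + w ≤ N then (pinnedChain ω₂ lam β γ).bondCurrent N i x else 0

/-- Number of bonds in the block `B_w`: `N - 1 - 2w` (truncated). -/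
def blockSize (N w : ℕ) : ℕ := N - 1 - 2 * w

/-- The normalised Gibbs measure `μ_T` of the pinned chain. -/
def μT (ω₂ lam β γ : ℝ) (N : ℕ) (T : ℝ) : Measure (PhaseSpace N) :=
  (pinnedChain ω₂ lam β γ).gibbsMeasure N T

/-- `(P_t F)(x) = ∫ F dP_t(x, ·)` for the EQUILIBRIUM kernels (both baths at `T`). -/
def Pt (ω₂ lam β γ : ℝ) (N : ℕ) (T t : ℝ) (F : PhaseSpace N → ℝ) (x : PhaseSpace N) : ℝ :=
  ∫ y, F y ∂((pinnedChain ω₂ lam β γ).transitionKernel N T T t.toNNReal x)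

/-- `P_t J`. -/
def PtJ (ω₂ lam β γ : ℝ) (N : ℕ) (T t : ℝ) (x : PhaseSpace N) : ℝ :=
  Pt ω₂ lam β γ N T t (Jtot ω₂ lam β γ N) x

/-- Finite-horizon Kubo corrector `u_τ(x) = ∫₀^τ (P_tJ)(x) dt` (= `E_x[Q_τ]`, `Q_τ = ∫₀^τ J(x_t)dt`). -/
def uTau (ω₂ lam β γ : ℝ) (N : ℕ) (T τ : ℝ) (x : PhaseSpace N) : ℝ :=
  ∫ t in Ioc (0 : ℝ) τ, PtJ ω₂ lam β γ N T t x

/-- The same for the bulk block: `u^B_τ(x) = ∫₀^τ (P_t J_B)(x) dt`. -/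
def uTauBlock (ω₂ lam β γ : ℝ) (N w : ℕ) (T τ : ℝ) (x : PhaseSpace N) : ℝ :=
  ∫ t in Ioc (0 : ℝ) τ, Pt ω₂ lam β γ N T t (Jblock ω₂ lam β γ N w) x

/-- Equilibrium current autocorrelation of the OPEN chain, `C(t) = ⟨J, P_tJ⟩_{L²(μ_T)}`. -/
def autocorr (ω₂ lam β γ : ℝ) (N : ℕ) (T t : ℝ) : ℝ :=
  ∫ x, Jtot ω₂ lam β γ N x * PtJ ω₂ lam β γ N T t x ∂(μT ω₂ lam β γ N T)

/-- Block autocorrelation `C_B(t) = ⟨J_B, P_tJ_B⟩`. -/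
def autocorrBlock (ω₂ lam β γ : ℝ) (N w : ℕ) (T t : ℝ) : ℝ :=
  ∫ x, Jblock ω₂ lam β γ N w x * Pt ω₂ lam β γ N T t (Jblock ω₂ lam β γ N w) x ∂(μT ω₂ lam β γ N T)

/-- `M₀ = ∫₀^∞ C(t) dt` (`= ⟨J, u⟩ = (N−1)T² D_N`, the open-chain Green–Kubo formula of KDN2009 / item 9146). -/
def zerothMoment (ω₂ lam β γ : ℝ) (N : ℕ) (T : ℝ) : ℝ :=
  ∫ t in Ioi (0 : ℝ), autocorr ω₂ lam β γ N T t

/-- `M₁ = ∫₀^∞ t C(t) dt` — the FIRST MOMENT of the open-chain current autocorrelation (the new scalar of the line). -/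
def firstMoment (ω₂ lam β γ : ℝ) (N : ℕ) (T : ℝ) : ℝ :=
  ∫ t in Ioi (0 : ℝ), t * autocorr ω₂ lam β γ N T t

/-- Second moment of the integrated block current of the stationary open chain,
`E[(Q^B_τ)²] = 2∫₀^τ (τ − r) C_B(r) dr`. -/
def secondMomentQ (ω₂ lam β γ : ℝ) (N w : ℕ) (T τ : ℝ) : ℝ :=
  2 * ∫ r in Ioc (0 : ℝ) τ, (τ - r) * autocorrBlock ω₂ lam β γ N w T r

/-- Two-replica overlap `E[Q^B_τ Q̃^B_τ] = ‖u^B_τ‖²_{L²(μ_T)}`. -/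
def replicaOverlap (ω₂ lam β γ : ℝ) (N w : ℕ) (T τ : ℝ) : ℝ :=
  ∫ x, (uTauBlock ω₂ lam β γ N w T τ x) ^ 2 ∂(μT ω₂ lam β γ N T)

/-- The Kubo-corrector predicate of item 9146: `u ∈ L²(μ_T)` is the a.e. limit of `u_τ`. -/
def IsKuboCorrector (ω₂ lam β γ : ℝ) (N : ℕ) (T : ℝ) (u : PhaseSpace N → ℝ) : Prop :=
  MemLp u 2 (μT ω₂ lam β γ N T) ∧
    ∀ᵐ x ∂(μT ω₂ lam β γ N T), Tendsto (fun τ : ℝ => uTau ω₂ lam β γ N T τ x) atTop (𝓝 (u x))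

/-- Absolute convergence of the corrector in `L²(μ_T)`: `∫₀^∞ ‖P_tJ‖_{L²(μ_T)} dt < ∞` (fixed `N`; CEHR-type input,
the same integrability the route's engine 9139 asks for, without any `N`-uniformity). -/
def CorrectorConverges (ω₂ lam β γ : ℝ) (N : ℕ) (T : ℝ) : Prop :=
  IntegrableOn (fun t : ℝ => Real.sqrt (∫ x, (PtJ ω₂ lam β γ N T t x) ^ 2 ∂(μT ω₂ lam β γ N T))) (Ioi 0)

/-- Invariance of `μ_T` under the equilibrium kernels (`μ_T P_t = μ_T`): contraction of `P_t` on `L²(μ_T)`. -/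
def GibbsInvariant (ω₂ lam β γ : ℝ) (N : ℕ) (T : ℝ) : Prop :=
  ∀ t : ℝ≥0, (μT ω₂ lam β γ N T).bind ((pinnedChain ω₂ lam β γ).transitionKernel N T T t) = μT ω₂ lam β γ N T

/-- Generalised detailed balance of the equilibrium open chain in `L²(μ_T)`:
`⟨f, P_t g⟩ = ⟨g∘Θ, P_t (f∘Θ)⟩`, i.e. `P_t† = Θ P_t Θ` (KDN2009 (reln2), MaesNetocny2010 §4; EPR-B 1999). -/
def DetailedBalance (ω₂ lam β γ : ℝ) (N : ℕ) (T : ℝ) : Prop :=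
  ∀ (f g : PhaseSpace N → ℝ) (t : ℝ), 0 ≤ t →
    MemLp f 2 (μT ω₂ lam β γ N T) → MemLp g 2 (μT ω₂ lam β γ N T) →
      ∫ x, f x * Pt ω₂ lam β γ N T t g x ∂(μT ω₂ lam β γ N T) =
        ∫ x, g (x.1, -x.2) * Pt ω₂ lam β γ N T t (fun y => f (y.1, -y.2)) x ∂(μT ω₂ lam β γ N T)

/-! ### First lemma (E1): the parity–moment identity -/

/-- **First lemma (E1).** For the Kubo corrector `u` of the equilibrium open chain:
`⟨u, u∘Θ⟩_{μ_T} = −M₁`, hence `‖u − u∘Θ‖² = 2‖u‖² + 2M₁` and `‖u + u∘Θ‖² = 2‖u‖² − 2M₁ (≥ 0)`.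
Proof sketch: `⟨P_tJ, (P_sJ)∘Θ⟩ = ⟨J, P_t†Θ P_sJ⟩ = ⟨J, Θ P_{t+s} J⟩ = −C(t+s)` (GDB + semigroup law + `J∘Θ = −J`);
Fubini is legitimate because `|C(t+s)| ≤ ‖P_tJ‖‖P_sJ‖` and `∫‖P_tJ‖ < ∞`; then `∫₀^∞∫₀^∞ C(t+s) = ∫₀^∞ r C(r) dr`. -/
def ParityMomentIdentity : Prop :=
  ∀ ω₂ lam β γ : ℝ, 0 < ω₂ → 0 < lam → 0 < β → 0 < γ → ∀ T : ℝ, 0 < T → ∀ (N : ℕ) (u : PhaseSpace N → ℝ),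
    GibbsInvariant ω₂ lam β γ N T → DetailedBalance ω₂ lam β γ N T → CorrectorConverges ω₂ lam β γ N T →
    IsKuboCorrector ω₂ lam β γ N T u →
      (∫ x, u x * u (x.1, -x.2) ∂(μT ω₂ lam β γ N T) = - firstMoment ω₂ lam β γ N T) ∧
      (∫ x, (u x - u (x.1, -x.2)) ^ 2 ∂(μT ω₂ lam β γ N T)
          = 2 * ∫ x, (u x) ^ 2 ∂(μT ω₂ lam β γ N T) + 2 * firstMoment ω₂ lam β γ N T) ∧
      (∫ x, (u x + u (x.1, -x.2)) ^ 2 ∂(μT ω₂ lam β γ N T)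
          = 2 * ∫ x, (u x) ^ 2 ∂(μT ω₂ lam β γ N T) - 2 * firstMoment ω₂ lam β γ N T)

/-! ### (E2) finite-horizon floor and (E3) replica formula -/

/-- **(E2)** `‖u‖² ≥ ¼‖u_τ‖²` for every horizon `τ > 0` (`u = u_τ + P_τu`, `P_τ` a contraction on `L²(μ_T)`). -/
def FiniteHorizonFloor : Prop :=
  ∀ ω₂ lam β γ : ℝ, 0 < ω₂ → 0 < lam → 0 < β → 0 < γ → ∀ T : ℝ, 0 < T → ∀ (N : ℕ) (u : PhaseSpace N → ℝ),
    GibbsInvariant ω₂ lam β γ N T → CorrectorConverges ω₂ lam β γ N T → IsKuboCorrector ω₂ lam β γ N T u →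
      ∀ τ : ℝ, 0 < τ →
        ∫ x, (uTau ω₂ lam β γ N T τ x) ^ 2 ∂(μT ω₂ lam β γ N T) ≤ 4 * ∫ x, (u x) ^ 2 ∂(μT ω₂ lam β γ N T)

/-- **(E3)** the replica formula `‖u^B_τ‖² = ∫₀^τ∫₀^τ ⟨P_tJ_B, P_sJ_B⟩ ds dt` and the one-replica ceiling
`‖u^B_τ‖² ≤ E[(Q^B_τ)²]` (conditional Jensen / Markov property). -/
def ReplicaFormula : Prop :=
  ∀ ω₂ lam β γ : ℝ, 0 < ω₂ → 0 < lam → 0 < β → 0 < γ → ∀ T : ℝ, 0 < T → ∀ (N w : ℕ) (τ : ℝ), 0 < τ →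
    GibbsInvariant ω₂ lam β γ N T →
      replicaOverlap ω₂ lam β γ N w T τ =
          ∫ p in Ioc (0 : ℝ) τ ×ˢ Ioc (0 : ℝ) τ,
            ∫ x, Pt ω₂ lam β γ N T p.1 (Jblock ω₂ lam β γ N w) x * Pt ω₂ lam β γ N T p.2 (Jblock ω₂ lam β γ N w) x
              ∂(μT ω₂ lam β γ N T) ∧
      replicaOverlap ω₂ lam β γ N w T τ ≤ secondMomentQ ω₂ lam β γ N w T τ

/-! ### The crux read on the corrector -/

/-- `CorrectorNormBound` — SI transported by (E1) + 9146: `2N(‖u‖² + M₁)/((N−1)²T⁴) ≤ C` uniformly in `N ≥ 2`. -/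
def CorrectorNormBound : Prop :=
  ∀ ω₂ lam β γ : ℝ, 0 < ω₂ → 0 < lam → 0 < β → 0 < γ → ∀ T : ℝ, 0 < T → ∃ C : ℝ, ∀ (N : ℕ) (u : PhaseSpace N → ℝ),
    2 ≤ N → IsKuboCorrector ω₂ lam β γ N T u →
      2 * (N : ℝ) * ((∫ x, (u x) ^ 2 ∂(μT ω₂ lam β γ N T)) + firstMoment ω₂ lam β γ N T) / (((N : ℝ) - 1) ^ 2 * T ^ 4) ≤ C

/-- SI ⟺ `CorrectorNormBound`, given the route's own supports (uniqueness identifies `μ N T T` with `μ_T`; 9146 gives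
`h − h∘Θ = (u − u∘Θ)/((N−1)T²)`; (E1) converts `‖u − u∘Θ‖²`).  [Transfer statement of the card.] -/
def SIReadsOnCorrector : Prop :=
  NessUnique → GibbsSteadyState → OddDensityIsCorrector → ParityMomentIdentity →
    (∀ ω₂ lam β γ : ℝ, 0 < ω₂ → 0 < lam → 0 < β → 0 < γ → ∀ T : ℝ, 0 < T → ∀ N : ℕ,
        GibbsInvariant ω₂ lam β γ N T ∧ DetailedBalance ω₂ lam β γ N T ∧ CorrectorConverges ω₂ lam β γ N T) →
    (OddResponseBound ↔ CorrectorNormBound)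

/-- **First-moment floor**: `a_N ≥ 4N·M₁/((N−1)²T⁴)` (since `‖u‖² ≥ M₁` by the third line of (E1)); so SI forces an
`N`-uniform bound on the Green–Kubo correlation TIME `M₁/M₀` of the open chain (hypothesis-free consequence of SI). -/
def FirstMomentFloor : Prop :=
  NessUnique → GibbsSteadyState → OddDensityIsCorrector → ParityMomentIdentity →
    (∀ ω₂ lam β γ : ℝ, 0 < ω₂ → 0 < lam → 0 < β → 0 < γ → ∀ T : ℝ, 0 < T → ∀ N : ℕ,
        GibbsInvariant ω₂ lam β γ N T ∧ DetailedBalance ω₂ lam β γ N T ∧ CorrectorConverges ω₂ lam β γ N T) →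
    OddResponseBound →
      ∀ ω₂ lam β γ : ℝ, 0 < ω₂ → 0 < lam → 0 < β → 0 < γ → ∀ T : ℝ, 0 < T → ∃ C : ℝ, ∀ N : ℕ, 2 ≤ N →
        4 * (N : ℝ) * firstMoment ω₂ lam β γ N T / (((N : ℝ) - 1) ^ 2 * T ^ 4) ≤ C

/-! ### Inputs of the conditional refutation -/

/-- **TwoReplicaDeterminism** (weak causality, kernel form — no isolated-flow object needed): along horizons
`τ_N → ∞` and margins `w_N = o(N)`, two copies of the equilibrium open chain started from the same `x₀ ∼ μ_T` with
independent bath noises carry the same integrated BULK current up to `o(N τ_N)` in mean square: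
`E[(Q^B_τ)²] − E[Q^B_τ Q̃^B_τ] = ½E[(Q^B_τ − Q̃^B_τ)²] = o(N τ_N)`. (Nearest-neighbour Gronwall/Picard bound with
Gibbs moment control; super-exponentially small once `w_N ≫ τ_N log(N τ_N)`.) -/
def TwoReplicaDeterminism (w τ : ℕ → ℕ) : Prop :=
  ∀ ω₂ lam β γ : ℝ, 0 < ω₂ → 0 < lam → 0 < β → 0 < γ → ∀ T : ℝ, 0 < T →
    Tendsto (fun N : ℕ =>
        (secondMomentQ ω₂ lam β γ N (w N) T (τ N) - replicaOverlap ω₂ lam β γ N (w N) T (τ N)) / ((N : ℝ) * (τ N)))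
      atTop (𝓝 0)

/-- **TruncatedGKPositive** (the bulk conducts at equilibrium, mesoscopic form): the integrated block current of the
stationary open chain fluctuates at least diffusively on the horizons `τ_N`:
`E[(Q^B_τ)²] ≥ 2κ₋T²·|B|·τ` eventually.  (Truncated Green–Kubo integral bounded below; fails only for an insulating bulk.) -/
def TruncatedGKPositive (w τ : ℕ → ℕ) : Prop :=
  ∀ ω₂ lam β γ : ℝ, 0 < ω₂ → 0 < lam → 0 < β → 0 < γ → ∀ T : ℝ, 0 < T → ∃ κ₀ : ℝ, 0 < κ₀ ∧
    ∀ᶠ N : ℕ in atTop, 2 * κ₀ * T ^ 2 * (blockSize N (w N) : ℝ) * (τ N) ≤ secondMomentQ ω₂ lam β γ N (w N) T (τ N)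

/-- **FirstMomentMild**: the first moment of the open-chain current autocorrelation is not hugely negative,
`M₁ ≥ −A·N` (hydrodynamics: `M₁ = O(N)`, short-time part `+O(N τ_c)`, contact tail `−O(ℓ_c² N/D)`). -/
def FirstMomentMild : Prop :=
  ∀ ω₂ lam β γ : ℝ, 0 < ω₂ → 0 < lam → 0 < β → 0 < γ → ∀ T : ℝ, 0 < T → ∃ A : ℝ, ∀ N : ℕ, 2 ≤ N →
    -(A * N) ≤ firstMoment ω₂ lam β γ N T

/-- Admissible horizon/margin sequences: `τ_N → ∞`, `w_N ≥ τ_N²` eventually (super-linear causal margin), and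
`τ_N·w_N = o(N)` (room for the crude boundary-zone subtraction `‖u^∂_τ‖ ≤ τ‖J_∂‖ ≤ τ√(c_∂ w)` against `√(2κ₋T²Nτ)`;
it forces `τ_N³ = o(N)` and `w_N = o(N)`). Example: `τ_N = ⌊N^{1/4}⌋`, `w_N = ⌊N^{1/2}⌋`. -/
def AdmissibleHorizons (w τ : ℕ → ℕ) : Prop :=
  Tendsto τ atTop atTop ∧
  (∀ᶠ N : ℕ in atTop, (τ N) ^ 2 ≤ w N) ∧
  Tendsto (fun N : ℕ => (τ N : ℝ) * (w N : ℝ) / N) atTop (𝓝 0)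

/-- Fixed-`N` regularity bundle used throughout (Gibbs invariance, detailed balance, corrector convergence). -/
def FixedNRegularity : Prop :=
  ∀ ω₂ lam β γ : ℝ, 0 < ω₂ → 0 < lam → 0 < β → 0 < γ → ∀ T : ℝ, 0 < T → ∀ N : ℕ,
    GibbsInvariant ω₂ lam β γ N T ∧ DetailedBalance ω₂ lam β γ N T ∧ CorrectorConverges ω₂ lam β γ N T

/-! ### The two conditional refutations of SI -/

/-- **ReplicaRefutation (stand-alone form).** Route supports + (E1) + the three equilibrium inputs ⟹ ¬SI.
Chain: `‖u‖² ≥ ¼‖u_τ‖²` (E2) `≥ ¼(‖u^B_τ‖ − τ‖J_∂‖)²` (triangle; `‖J_∂‖² ≤ c·2w` by CurrentVarianceLinear-type bound)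
with `‖u^B_τ‖² ≥ E[(Q^B_τ)²] − o(Nτ) ≥ 2κ₋T²|B|τ − o(Nτ)` (E3 + determinism + truncated GK), so `‖u‖² ≥ ½κ₋T²Nτ_N(1 − o(1))`;
then (E1): `a_N = 2N(‖u‖² + M₁)/((N−1)²T⁴) ≥ (κ₋/T²) τ_N (1 − o(1)) − 2A/T⁴ → ∞`, contradicting `a_N ≤ C`. -/
def ReplicaRefutation : Prop :=
  ∀ w τ : ℕ → ℕ, AdmissibleHorizons w τ →
    NessUnique → GibbsSteadyState → CurrentVarianceLinear → OddDensityIsCorrector →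
    FixedNRegularity → ParityMomentIdentity → FiniteHorizonFloor → ReplicaFormula →
    TwoReplicaDeterminism w τ → TruncatedGKPositive w τ → FirstMomentMild →
      ¬ OddResponseBound

/-- **AbsFirstMoment** — `∫₀^∞ t·|C_N(t)| dt ≤ A′N` (N-uniform absolute first moment of the open-chain autocorrelation,
per unit length).  Gives both `FirstMomentMild` and, with `M₀ = (N−1)T²D_N ≥ (N−1)T²d`, the variance floor
`E[(Q_τ)²] = 2∫₀^τ(τ−t)C ≥ 2τM₀ − 4A′N`. -/
def AbsFirstMoment : Prop :=
  ∀ ω₂ lam β γ : ℝ, 0 < ω₂ → 0 < lam → 0 < β → 0 < γ → ∀ T : ℝ, 0 < T → ∃ A : ℝ, ∀ N : ℕ, 2 ≤ N →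
    IntegrableOn (fun t : ℝ => t * |autocorr ω₂ lam β γ N T t|) (Ioi 0) ∧
    ∫ t in Ioi (0 : ℝ), t * |autocorr ω₂ lam β γ N T t| ≤ A * N

/-- **RouteInconsistency (in-route form).** Inside the route the conduction input is free: SI ⟹ BoundedResponse
(OddSufficiency) ⟹ `D_N → k > 0` (BoundedResponseConverges 9141) ⟹ `M₀ = (N−1)T²D_N ≥ (N−1)T²k/2` eventually (9146's
Green–Kubo consistency), and `AbsFirstMoment` turns this into the variance floor; the replica chain then gives
`a_N → ∞`.  So the route's hypotheses + (weak causality, absolute first moment) are jointly contradictory. -/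
def RouteInconsistency : Prop :=
  ∀ w τ : ℕ → ℕ, AdmissibleHorizons w τ →
    NessUnique → GibbsSteadyState → CurrentVarianceLinear → ResponseDensity → FiniteResponseOfUnique →
    OddDensityIsCorrector → OddSufficiency → BoundedResponseConverges →
    FixedNRegularity → ParityMomentIdentity → FiniteHorizonFloor → ReplicaFormula →
    TwoReplicaDeterminism w τ → AbsFirstMoment →
      OddResponseBound → False

/-! ### Two abstract lemmas of the line (PROVED): the algebra of (E1) and the floor (E2) -/

/-- (E1), Hilbert-space algebra: for the retarded/advanced correctors `u⁺, u⁻` (equal norms, by `u⁻ = −u⁺∘Θ` and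
Θ-invariance of `μ_T`), `‖u⁺ + u⁻‖² = 2‖u⁺‖² + 2⟪u⁺, u⁻⟫` and `‖u⁺ − u⁻‖² = 2‖u⁺‖² − 2⟪u⁺, u⁻⟫`; the line identifies
`⟪u⁺, u⁻⟫ = M₁ = ∫₀^∞ t C(t) dt` and `u⁺ + u⁻ = u − u∘Θ = (N−1)T²(h − h∘Θ)`. -/
theorem parity_norm_split {E : Type*} [NormedAddCommGroup E] [InnerProductSpace ℝ E] (up um : E)
    (hn : ‖um‖ = ‖up‖) :
    ‖up + um‖ ^ 2 = 2 * ‖up‖ ^ 2 + 2 * inner ℝ up um ∧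
      ‖up - um‖ ^ 2 = 2 * ‖up‖ ^ 2 - 2 * inner ℝ up um := by
  constructor
  · rw [norm_add_sq_real, hn]; ring
  · rw [norm_sub_sq_real, hn]; ring

/-- Consequence used for the first-moment floor: `|⟪u⁺, u⁻⟫| ≤ ‖u⁺‖²`, i.e. `|M₁| ≤ ‖u‖²`. -/
theorem abs_overlap_le_norm_sq {E : Type*} [NormedAddCommGroup E] [InnerProductSpace ℝ E] (up um : E)
    (hn : ‖um‖ = ‖up‖) : |inner ℝ up um| ≤ ‖up‖ ^ 2 := by
  have h := abs_real_inner_le_norm up um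
  rw [hn] at h
  nlinarith [norm_nonneg up]

/-- (E2), normed-space form: `u = u_τ + P_τ u` with `‖P_τ u‖ ≤ ‖u‖` gives `‖u_τ‖ ≤ 2‖u‖` — no rate, no late-time input. -/
theorem finite_horizon_floor {E : Type*} [SeminormedAddCommGroup E] (u uτ Pu : E) (h : u = uτ + Pu)
    (hc : ‖Pu‖ ≤ ‖u‖) : ‖uτ‖ ≤ 2 * ‖u‖ := by
  have h' : uτ = u - Pu := by rw [h]; abel
  calc ‖uτ‖ = ‖u - Pu‖ := by rw [h']
    _ ≤ ‖u‖ + ‖Pu‖ := norm_sub_le _ _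
    _ ≤ 2 * ‖u‖ := by linarith

/-! ### Sanity: the route decls we lean on are the ones named above -/
example : OddResponseBound = Summit.AtomisticToContinuum.FouriersLaw.Theses.OddSectorIrreversibility.OddResponseBound := rfl
example : EngineGlue = (GibbsSteadyState → NessUnique → CurrentVarianceLinear → OddDensityIsCorrector →
    OddCorrectorDecay → OddResponseBound) := rfl

end Summit.AtomisticToContinuum.FouriersLaw.Cruxes.OddResponseBound.ReplicaParityMoment

end
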